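import Mathlib
import HarnessLib
import Literature.Analysis.FunctionSpaces.BMOCarlesonProofs
import Summits.QuantumFields.YangMills.Theorems.ComplexCouplingChannelContinuumLegGivenGapProductToUniformNearDiagonal

/-!
# `stub_ptuAnalysis` — the analytic kit of `stub_productToUniform`
# (crux `ContinuumLegGivenGap`, stmt-QuantumFields-15828, line `alternating-curvature-arrays`)

Registered stub of the line (VERBATIM signature), a self-contained pair of Schwartz-space / lattice-sum estimates:

* **(a) the abstract flat/decay bound.** For `F ∈ ⁰𝒮((ℝ⁴)^p)` (`IsOffDiagonal`) and a smooth compactly supported real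
  weight `w` with geometric derivative bounds `‖Dⁱ w‖ ≤ A Dⁱ` (`i ≤ n`), supported where some pair of points is `δ`-close
  and `‖y‖ ≥ d`:  `|w F|_n ≤ A (2 max(1,D))ⁿ 2^{K+1} δ^M (1+d)^{-K} |F|_{n+M+K}`.  Route: `schwartzNorm` is a finite sup of
  the seminorms `sup_y ‖y‖^k ‖D^l · (y)‖`, `k, l ≤ n`; off `tsupport w` all derivatives of `w F` vanish; on it, Leibniz
  (`norm_iteratedFDeriv_mul_le`, `∑ᵢ (l choose i) Dⁱ = (1+D)^l ≤ (2 max(1,D))ⁿ`) and, for the factor `‖y‖^k ‖D^{l-i} F(y)‖`,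
  WEIGHTED FLATNESS OF DERIVATIVES of `F` at the coincident point (`ptuAnalysis_pow_mul_norm_iteratedFDeriv_le`: the tree's
  iterated-mean-value lemma `norm_iteratedFDeriv_le_of_vanish` along the max-coordinate-preserving segment of
  `offDiagonal_pow_mul_norm_le`) with the weights `‖y‖^k` and `‖y‖^{k+K}`:
  `(1+‖y‖)^K ‖y‖^k ‖D^{l-i}F(y)‖ ≤ 2^K (1 + ‖y‖^K) ‖y‖^k ‖D^{l-i}F(y)‖ ≤ 2^{K+1} δ^M |F|_{n+M+K}` (the tree's
  `one_add_pow_le_two_pow_mul`), and `(1+‖y‖)^K ≥ (1+d)^K`.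
* **(b) the seam bound.** `∑ ‖F(a x⃗)‖` over box configurations `x⃗ ∈ (box L)^p` with a coordinate beyond `L/8` is at most
  `(64 K₀ 2^{16N})^{p+1} |F|_{p(4N+6)}` when `0 < a ≤ 1`, `a⁻¹ ≤ (aL)^N` (`K₀ = 81 ∑ₘ (m+1)⁻²`): Schwartz decay
  `‖F(y)‖ ≤ 2^k |F|_k (1+‖y‖)^{-k}`, `k = 4pN + 6p` (`SchwartzMap.one_add_le_sup_seminorm_apply`), `‖y‖ ≥ aL/8` on the seam,
  `(1+‖y‖)^{-6p} ≤ ∏ᵢ (1 + a‖xᵢ‖)^{-6}` (`inv_one_add_norm_pow_le_prod`) summed by `nearDiag_sum_weights_le` (`≤ a^{-4p} K₀^p`), and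
  `a^{-4p} ≤ (aL)^{4pN}`, `(aL)^{4pN} (1 + aL/8)^{-4pN} ≤ 8^{4pN}`.

References: Osterwalder–Schrader 1975 §2 (`⁰𝒮`, the norms `|f|_m`); Glimm–Jaffe 1987 §6.1.  Mathlib + landed tree lemmas
only; no definitions. [folklore]
-/

set_option autoImplicit false

noncomputable section

namespace Summit.QuantumFields.YangMills.Theorems.ContinuumLegGivenGap

open scoped SchwartzMap BigOperators ContDiff Classical
open MeasureTheory Filter Topology
open Literature.MathematicalPhysics.QuantumFieldTheory Literature.MathematicalPhysics.QuantumLattice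
  Literature.MathematicalPhysics.AQFT
open Literature.Probability.LatticeModels (box Site)
open Literature.Analysis.FunctionSpaces.BMOInv (one_add_pow_le_two_pow_mul)
open Summit.QuantumFields.YangMills.Theorems.OSLegsFromFemtoAndGap
  (norm_iteratedFDeriv_le_of_vanish apply_eq_of_mem_segment_update norm_sub_update abs_coord_le_norm_siteToE
    mul_norm_le_norm_smul_siteToE inv_one_add_norm_pow_le_prod summable_inv_succ_sq)

/-! ## §1 Weighted flatness of DERIVATIVES of `⁰𝒮` functions at the coincidence locus -/

section Flat

variable {E : Type*} [NormedAddCommGroup E] [NormedSpace ℝ E] {n : ℕ}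

/-- **Weighted flat decay of derivatives.** For `F ∈ ⁰𝒮(Eⁿ)`, all `k l M : ℕ`, all `i ≠ j` and every `y`:
`‖y‖ᵏ · ‖D^l F(y)‖ ≤ 𝓢-seminorm_{k,l+M}(F) · ‖yᵢ − yⱼ‖^M` (iterated mean values along the segment from the coincident
point obtained by moving one point of the pair onto the other, keeping a coordinate of maximal norm fixed). [folklore] -/
theorem ptuAnalysis_pow_mul_norm_iteratedFDeriv_le (F : 𝓢((Fin n → E), ℂ)) (hF : IsOffDiagonal F) (k l M : ℕ)
    {i j : Fin n} (hij : i ≠ j) (y : Fin n → E) :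
    ‖y‖ ^ k * ‖iteratedFDeriv ℝ l F y‖ ≤ SchwartzMap.seminorm ℂ k (l + M) F * ‖y i - y j‖ ^ M := by
  classical
  by_cases hyij : y i = y j
  · have hy : y ∈ coincidenceLocus n E := ⟨i, j, hij, hyij⟩
    rw [hF y hy l, norm_zero, mul_zero]
    positivity
  have hypos : 0 < ‖y‖ := by
    by_contra h
    have h0 : y = 0 := norm_le_zero_iff.1 (not_lt.1 h)
    exact hyij (by simp [h0])
  -- a coordinate of maximal norm
  obtain ⟨c₀, -, hc₀⟩ := Finset.exists_max_image Finset.univ (fun c => ‖y c‖) ⟨i, Finset.mem_univ _⟩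
  have hyl : ‖y‖ = ‖y c₀‖ :=
    le_antisymm ((pi_norm_le_iff_of_nonneg (norm_nonneg _)).2 fun c => hc₀ c (Finset.mem_univ _))
      (norm_le_pi_norm y c₀)
  -- the coincident point `z`: move a point `c ≠ c₀` of the pair `{i, j}` onto the other one
  obtain ⟨c, v, hcl, hz, hdist⟩ : ∃ (c : Fin n) (v : E), c₀ ≠ c ∧
      Function.update y c v ∈ coincidenceLocus n E ∧ ‖y - Function.update y c v‖ = ‖y i - y j‖ := by
    by_cases hlj : c₀ = j
    · refine ⟨i, y j, fun h => hij (h.symm.trans hlj), ⟨i, j, hij, ?_⟩, ?_⟩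
      · simp [Function.update_of_ne (Ne.symm hij)]
      · rw [norm_sub_update]
    · refine ⟨j, y i, hlj, ⟨i, j, hij, ?_⟩, ?_⟩
      · simp [Function.update_of_ne hij]
      · rw [norm_sub_update, norm_sub_rev]
  set z := Function.update y c v with hzdef
  -- on the segment `[z, y]` the `c₀`-th coordinate is frozen, so `‖w‖ ≥ ‖y‖`
  have hw : ∀ w ∈ segment ℝ z y, ‖y‖ ≤ ‖w‖ := fun w hw => by
    have hwl : w c₀ = y c₀ := apply_eq_of_mem_segment_update hcl v hw
    rw [hyl, ← hwl]
    exact norm_le_pi_norm w c₀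
  set S := SchwartzMap.seminorm ℂ k (l + M) F with hS
  have hB : ∀ w ∈ segment ℝ z y, ‖iteratedFDeriv ℝ (l + M) (F : (Fin n → E) → ℂ) w‖ ≤ S / ‖y‖ ^ k := by
    intro w hwm
    rw [le_div_iff₀ (pow_pos hypos k)]
    calc ‖iteratedFDeriv ℝ (l + M) (F : (Fin n → E) → ℂ) w‖ * ‖y‖ ^ k
        ≤ ‖iteratedFDeriv ℝ (l + M) (F : (Fin n → E) → ℂ) w‖ * ‖w‖ ^ k := by gcongr; exact hw w hwm
      _ = ‖w‖ ^ k * ‖iteratedFDeriv ℝ (l + M) (F : (Fin n → E) → ℂ) w‖ := mul_comm _ _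
      _ ≤ S := SchwartzMap.le_seminorm ℂ k (l + M) F w
  have hz0 : ∀ m < l + M, iteratedFDeriv ℝ m (F : (Fin n → E) → ℂ) z = 0 := fun m _ => hF z hz m
  have key := norm_iteratedFDeriv_le_of_vanish (F.smooth ⊤) (by positivity) hz0 hB M (Nat.le_add_left M l) y
    (right_mem_segment ℝ z y)
  rw [Nat.add_sub_cancel, hdist] at key
  calc ‖y‖ ^ k * ‖iteratedFDeriv ℝ l F y‖ ≤ ‖y‖ ^ k * (S / ‖y‖ ^ k * ‖y i - y j‖ ^ M) := by gcongr
    _ = S * ‖y i - y j‖ ^ M := by field_simp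

/-- **Flatness and decay together.** For `F ∈ ⁰𝒮(Eⁿ)`, a point `y` with a `δ`-close pair and `‖y‖ ≥ d ≥ 0`, and orders
`k + K ≤ m`, `l + M ≤ m`:  `‖y‖^k ‖D^l F(y)‖ ≤ 2^{K+1} δ^M (1+d)^{-K} |F|_m`. [folklore] -/
theorem ptuAnalysis_pow_mul_norm_iteratedFDeriv_le_decay (F : 𝓢((Fin n → E), ℂ)) (hF : IsOffDiagonal F)
    {k l M K m : ℕ} (hk : k + K ≤ m) (hl : l + M ≤ m) {δ d : ℝ} (hd : 0 ≤ d) {y : Fin n → E} {i j : Fin n}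
    (hij : i ≠ j) (hyδ : ‖y i - y j‖ ≤ δ) (hyd : d ≤ ‖y‖) :
    ‖y‖ ^ k * ‖iteratedFDeriv ℝ l F y‖ ≤ 2 ^ (K + 1) * δ ^ M * ((1 + d) ^ K)⁻¹ * schwartzNorm m F := by
  set S := schwartzNorm m F with hS
  set X := ‖iteratedFDeriv ℝ l F y‖ with hX
  have hS0 : 0 ≤ S := schwartzNorm_nonneg m F
  have hδM : ‖y i - y j‖ ^ M ≤ δ ^ M := pow_le_pow_left₀ (norm_nonneg _) hyδ M
  have hδ0 : 0 ≤ δ ^ M := le_trans (pow_nonneg (norm_nonneg _) M) hδM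
  have h1 : ‖y‖ ^ k * X ≤ S * δ ^ M :=
    (ptuAnalysis_pow_mul_norm_iteratedFDeriv_le F hF k l M hij y).trans
      (mul_le_mul (seminorm_le_schwartzNorm (by omega) hl F) hδM (by positivity) hS0)
  have h2 : ‖y‖ ^ (k + K) * X ≤ S * δ ^ M :=
    (ptuAnalysis_pow_mul_norm_iteratedFDeriv_le F hF (k + K) l M hij y).trans
      (mul_le_mul (seminorm_le_schwartzNorm hk hl F) hδM (by positivity) hS0)
  have h3 : (1 + ‖y‖) ^ K * (‖y‖ ^ k * X) ≤ 2 ^ (K + 1) * δ ^ M * S := by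
    calc (1 + ‖y‖) ^ K * (‖y‖ ^ k * X) ≤ 2 ^ K * (1 + ‖y‖ ^ K) * (‖y‖ ^ k * X) := by
          gcongr; exact one_add_pow_le_two_pow_mul (norm_nonneg y) K
      _ = 2 ^ K * (‖y‖ ^ k * X + ‖y‖ ^ (k + K) * X) := by ring
      _ ≤ 2 ^ K * (S * δ ^ M + S * δ ^ M) := by gcongr
      _ = 2 ^ (K + 1) * δ ^ M * S := by ring
  have hdK : (1 + d) ^ K ≤ (1 + ‖y‖) ^ K := pow_le_pow_left₀ (by positivity) (by linarith) K
  have hdpos : 0 < (1 + d) ^ K := by positivity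
  rw [show 2 ^ (K + 1) * δ ^ M * ((1 + d) ^ K)⁻¹ * S = 2 ^ (K + 1) * δ ^ M * S / (1 + d) ^ K by ring,
    le_div_iff₀ hdpos]
  calc ‖y‖ ^ k * X * (1 + d) ^ K ≤ ‖y‖ ^ k * X * (1 + ‖y‖) ^ K := by gcongr
    _ = (1 + ‖y‖) ^ K * (‖y‖ ^ k * X) := by ring
    _ ≤ _ := h3

/-- Derivatives of the complexification of a real smooth function have the same norms. [folklore] -/
theorem ptuAnalysis_norm_iteratedFDeriv_ofReal {X : Type*} [NormedAddCommGroup X] [NormedSpace ℝ X] {w : X → ℝ}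
    (hw : ContDiff ℝ ∞ w) (i : ℕ) (y : X) :
    ‖iteratedFDeriv ℝ i (fun x => ((w x : ℝ) : ℂ)) y‖ = ‖iteratedFDeriv ℝ i w y‖ := by
  have hfun : (fun x => ((w x : ℝ) : ℂ)) = Complex.ofRealLI.toContinuousLinearMap ∘ w := rfl
  rw [hfun, Complex.ofRealLI.toContinuousLinearMap.iteratedFDeriv_comp_left hw.contDiffAt (i := i)
    (mod_cast le_top), LinearIsometry.norm_compContinuousMultilinearMap]

/-- **Pointwise form of (a).** Under the hypotheses of the flat/decay bound, for `k, l ≤ n` and every `y`: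
`‖y‖^k ‖D^l (w F)(y)‖ ≤ A (2 max(1,D))ⁿ 2^{K+1} δ^M (1+d)^{-K} |F|_{n+M+K}`. [folklore] -/
theorem ptuAnalysis_flat_pointwise {p n M K : ℕ} (F : 𝓢((Fin p → EuclideanSpace ℝ (Fin 4)), ℂ))
    (hF : IsOffDiagonal F) (w : (Fin p → EuclideanSpace ℝ (Fin 4)) → ℝ) {A D δ d : ℝ} (hw : ContDiff ℝ ∞ w)
    (hwc : HasCompactSupport w) (hA : 0 ≤ A) (hD : 0 ≤ D) (hδ : 0 ≤ δ) (hd : 0 ≤ d)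
    (hwD : ∀ i ≤ n, ∀ y : (Fin p → EuclideanSpace ℝ (Fin 4)), ‖iteratedFDeriv ℝ i w y‖ ≤ A * D ^ i)
    (hclose : ∀ y ∈ tsupport w, ∃ i j : Fin p, i ≠ j ∧ ‖y i - y j‖ ≤ δ) (hfar : ∀ y ∈ tsupport w, d ≤ ‖y‖)
    {k l : ℕ} (hk : k ≤ n) (hl : l ≤ n) (y : Fin p → EuclideanSpace ℝ (Fin 4)) :
    ‖y‖ ^ k * ‖iteratedFDeriv ℝ l
        (SchwartzMap.smulLeftCLM ℂ (fun y : (Fin p → EuclideanSpace ℝ (Fin 4)) => ((w y : ℝ) : ℂ)) F) y‖ ≤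
      A * (2 * max 1 D) ^ n * 2 ^ (K + 1) * δ ^ M * ((1 + d) ^ K)⁻¹ * schwartzNorm (n + M + K) F := by
  set wc : (Fin p → EuclideanSpace ℝ (Fin 4)) → ℂ := fun y => ((w y : ℝ) : ℂ) with hwc_def
  set G := SchwartzMap.smulLeftCLM ℂ wc F with hG
  set T : ℝ := 2 ^ (K + 1) * δ ^ M * ((1 + d) ^ K)⁻¹ * schwartzNorm (n + M + K) F with hT
  have hT0 : 0 ≤ T := mul_nonneg (by positivity) (schwartzNorm_nonneg _ F)
  have hRHS : A * (2 * max 1 D) ^ n * 2 ^ (K + 1) * δ ^ M * ((1 + d) ^ K)⁻¹ * schwartzNorm (n + M + K) F =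
      (2 * max 1 D) ^ n * (A * T) := by rw [hT]; ring
  -- the multiplier: smooth, compactly supported, hence of temperate growth
  have hwc1 : ContDiff ℝ ∞ wc := Complex.ofRealCLM.contDiff.comp hw
  have hwc2 : HasCompactSupport wc := hwc.comp_left (g := Complex.ofReal) Complex.ofReal_zero
  have hg : wc.HasTemperateGrowth := hwc2.hasTemperateGrowth hwc1
  have hcoe : ((G : 𝓢((Fin p → EuclideanSpace ℝ (Fin 4)), ℂ)) : (Fin p → EuclideanSpace ℝ (Fin 4)) → ℂ) =
      fun y => wc y * F y := by
    funext x
    simp only [hG, SchwartzMap.smulLeftCLM_apply_apply hg, smul_eq_mul]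
  have hsupp : tsupport (G : (Fin p → EuclideanSpace ℝ (Fin 4)) → ℂ) ⊆ tsupport w := by
    refine closure_mono fun x hx => ?_
    rw [Function.mem_support] at hx ⊢
    intro h0
    exact hx (by rw [hcoe]; simp [hwc_def, h0])
  by_cases hy : y ∈ tsupport w
  · obtain ⟨i, j, hij, hyδ⟩ := hclose y hy
    have hyd := hfar y hy
    have hLeib := norm_iteratedFDeriv_mul_le (𝕜 := ℝ) (N := (⊤ : ℕ∞)) hwc1 (F.smooth ⊤) y (n := l)
      (mod_cast le_top)
    have hterm : ∀ i' ∈ Finset.range (l + 1),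
        ‖y‖ ^ k * ((l.choose i' : ℝ) * ‖iteratedFDeriv ℝ i' wc y‖ *
          ‖iteratedFDeriv ℝ (l - i') (F : (Fin p → EuclideanSpace ℝ (Fin 4)) → ℂ) y‖) ≤
          (l.choose i' : ℝ) * D ^ i' * (A * T) := by
      intro i' hi'
      have hi'l : i' ≤ l := Nat.lt_succ_iff.1 (Finset.mem_range.1 hi')
      have h1 : ‖iteratedFDeriv ℝ i' wc y‖ ≤ A * D ^ i' := by
        rw [hwc_def, ptuAnalysis_norm_iteratedFDeriv_ofReal hw]; exact hwD i' (hi'l.trans hl) y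
      have h2 : ‖y‖ ^ k * ‖iteratedFDeriv ℝ (l - i') (F : (Fin p → EuclideanSpace ℝ (Fin 4)) → ℂ) y‖ ≤ T :=
        ptuAnalysis_pow_mul_norm_iteratedFDeriv_le_decay F hF (m := n + M + K) (K := K) (M := M)
          (by omega) (by omega) hd hij hyδ hyd
      calc ‖y‖ ^ k * ((l.choose i' : ℝ) * ‖iteratedFDeriv ℝ i' wc y‖ *
            ‖iteratedFDeriv ℝ (l - i') (F : (Fin p → EuclideanSpace ℝ (Fin 4)) → ℂ) y‖)
          = (l.choose i' : ℝ) * ‖iteratedFDeriv ℝ i' wc y‖ *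
              (‖y‖ ^ k * ‖iteratedFDeriv ℝ (l - i') (F : (Fin p → EuclideanSpace ℝ (Fin 4)) → ℂ) y‖) := by
            ring
        _ ≤ (l.choose i' : ℝ) * (A * D ^ i') * T := by gcongr
        _ = (l.choose i' : ℝ) * D ^ i' * (A * T) := by ring
    have hbin : ∑ i' ∈ Finset.range (l + 1), (l.choose i' : ℝ) * D ^ i' * (A * T) = (1 + D) ^ l * (A * T) := by
      rw [← Finset.sum_mul, show (1 + D) ^ l = (D + 1) ^ l by ring, add_pow]
      congr 1
      exact Finset.sum_congr rfl fun i' _ => by ring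
    have hmax : (1 + D) ^ l ≤ (2 * max 1 D) ^ n :=
      (pow_le_pow_left₀ (by positivity) (by linarith [le_max_left 1 D, le_max_right 1 D] : 1 + D ≤ 2 * max 1 D)
        l).trans (pow_le_pow_right₀ (by linarith [le_max_left 1 D]) hl)
    rw [hcoe, hRHS]
    calc ‖y‖ ^ k * ‖iteratedFDeriv ℝ l (fun y => wc y * F y) y‖
        ≤ ‖y‖ ^ k * ∑ i' ∈ Finset.range (l + 1), (l.choose i' : ℝ) * ‖iteratedFDeriv ℝ i' wc y‖ *
            ‖iteratedFDeriv ℝ (l - i') (F : (Fin p → EuclideanSpace ℝ (Fin 4)) → ℂ) y‖ :=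
          mul_le_mul_of_nonneg_left hLeib (by positivity)
      _ = ∑ i' ∈ Finset.range (l + 1), ‖y‖ ^ k * ((l.choose i' : ℝ) * ‖iteratedFDeriv ℝ i' wc y‖ *
            ‖iteratedFDeriv ℝ (l - i') (F : (Fin p → EuclideanSpace ℝ (Fin 4)) → ℂ) y‖) := by
          rw [Finset.mul_sum]
      _ ≤ ∑ i' ∈ Finset.range (l + 1), (l.choose i' : ℝ) * D ^ i' * (A * T) := Finset.sum_le_sum hterm
      _ = (1 + D) ^ l * (A * T) := hbin
      _ ≤ (2 * max 1 D) ^ n * (A * T) := mul_le_mul_of_nonneg_right hmax (mul_nonneg hA hT0)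
  · -- off the support of `w` all derivatives of `w F` vanish
    have h0 : iteratedFDeriv ℝ l (G : (Fin p → EuclideanSpace ℝ (Fin 4)) → ℂ) y = 0 := by
      by_contra hne
      exact hy (hsupp (support_iteratedFDeriv_subset l (Function.mem_support.2 hne)))
    rw [h0, norm_zero, mul_zero, hRHS]
    exact mul_nonneg (by positivity) (mul_nonneg hA hT0)

/-- **(a) The abstract flat/decay bound** (first conjunct of `stub_ptuAnalysis`). [folklore] -/
theorem ptuAnalysis_flat : ∀ (p n M K : ℕ) (F : 𝓢((Fin p → EuclideanSpace ℝ (Fin 4)), ℂ)), IsOffDiagonal F →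
    ∀ (w : (Fin p → EuclideanSpace ℝ (Fin 4)) → ℝ) (A D δ d : ℝ), ContDiff ℝ ∞ w → HasCompactSupport w →
      0 ≤ A → 0 ≤ D → 0 ≤ δ → 0 ≤ d →
      (∀ i ≤ n, ∀ y : (Fin p → EuclideanSpace ℝ (Fin 4)), ‖iteratedFDeriv ℝ i w y‖ ≤ A * D ^ i) →
      (∀ y ∈ tsupport w, ∃ i j : Fin p, i ≠ j ∧ ‖y i - y j‖ ≤ δ) →
      (∀ y ∈ tsupport w, d ≤ ‖y‖) →
      schwartzNorm n (SchwartzMap.smulLeftCLM ℂ (fun y : (Fin p → EuclideanSpace ℝ (Fin 4)) => ((w y : ℝ) : ℂ)) F) ≤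
        A * (2 * max 1 D) ^ n * 2 ^ (K + 1) * δ ^ M * ((1 + d) ^ K)⁻¹ * schwartzNorm (n + M + K) F := by
  intro p n M K F hF w A D δ d hw hwc hA hD hδ hd hwD hclose hfar
  have hC0 : 0 ≤ A * (2 * max 1 D) ^ n * 2 ^ (K + 1) * δ ^ M * ((1 + d) ^ K)⁻¹ * schwartzNorm (n + M + K) F :=
    mul_nonneg (by positivity) (schwartzNorm_nonneg _ F)
  unfold schwartzNorm
  refine Seminorm.finset_sup_apply_le hC0 ?_
  rintro ⟨k, l⟩ hkl
  obtain ⟨hk, hl⟩ := Prod.mk_le_mk.1 (Finset.mem_Iic.1 hkl)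
  rw [SchwartzMap.schwartzSeminormFamily_apply]
  exact SchwartzMap.seminorm_le_bound ℂ k l _ hC0 fun y =>
    ptuAnalysis_flat_pointwise F hF w hw hwc hA hD hδ hd hwD hclose hfar hk hl y

end Flat

/-! ## §2 The seam -/

/-- **Pointwise seam bound.** For a lattice configuration `x⃗` with `‖a x⃗‖ ≥ R ≥ 0`:
`‖F(a x⃗)‖ ≤ 2^{k₁+6p} |F|_{k₁+6p} (1+R)^{-k₁} ∏ᵢ ((1 + a‖xᵢ‖)⁶)⁻¹`. [folklore] -/
theorem ptuAnalysis_seam_norm_apply_le {p : ℕ} (F : 𝓢((Fin p → EuclideanSpace ℝ (Fin 4)), ℂ)) {a : ℝ}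
    (ha : 0 ≤ a) (k₁ : ℕ) {R : ℝ} (hR : 0 ≤ R) (x : Fin p → Site 4)
    (hx : R ≤ ‖(fun l => a • siteToE (x l) : Fin p → EuclideanSpace ℝ (Fin 4))‖) :
    ‖F (fun l => a • siteToE (x l))‖ ≤ 2 ^ (k₁ + 6 * p) * schwartzNorm (k₁ + 6 * p) F * ((1 + R) ^ k₁)⁻¹ *
      ∏ l, ((1 + a * ‖x l‖) ^ 6)⁻¹ := by
  set y : Fin p → EuclideanSpace ℝ (Fin 4) := fun l => a • siteToE (x l) with hy
  set k := k₁ + 6 * p with hk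
  set S := schwartzNorm k F with hS
  have hS0 : 0 ≤ S := schwartzNorm_nonneg k F
  have h1 : (1 + ‖y‖) ^ k * ‖F y‖ ≤ 2 ^ k * S := by
    have h := SchwartzMap.one_add_le_sup_seminorm_apply (𝕜 := ℂ) (m := (k, 0)) le_rfl le_rfl F y
    rw [norm_iteratedFDeriv_zero] at h
    have hsup : (Finset.Iic (k, 0)).sup (fun m : ℕ × ℕ => SchwartzMap.seminorm ℂ m.1 m.2) F ≤ S :=
      Seminorm.le_def.1 (Finset.sup_mono (f := schwartzSeminormFamily ℂ _ ℂ)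
        (Finset.Iic_subset_Iic.2 (Prod.mk_le_mk.2 ⟨le_rfl, Nat.zero_le k⟩))) F
    exact h.trans (mul_le_mul_of_nonneg_left hsup (by positivity))
  have hpos : 0 < (1 + ‖y‖) ^ k := by positivity
  have h2 : ‖F y‖ ≤ 2 ^ k * S * ((1 + ‖y‖) ^ k)⁻¹ := by
    rw [← div_eq_mul_inv, le_div_iff₀ hpos, mul_comm]; exact h1
  have h3 : ((1 + ‖y‖) ^ k)⁻¹ ≤ ((1 + R) ^ k₁)⁻¹ * ∏ l, ((1 + a * ‖x l‖) ^ 6)⁻¹ := by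
    rw [hk, pow_add, mul_inv]
    refine mul_le_mul ?_ ?_ (by positivity) (by positivity)
    · exact inv_anti₀ (by positivity) (pow_le_pow_left₀ (by positivity) (by linarith) k₁)
    · have h := inv_one_add_norm_pow_le_prod ha x y (fun l => mul_norm_le_norm_smul_siteToE ha (x l)) 6
      rwa [← inv_pow, ← pow_mul, inv_pow] at h
  calc ‖F y‖ ≤ 2 ^ k * S * ((1 + ‖y‖) ^ k)⁻¹ := h2
    _ ≤ 2 ^ k * S * (((1 + R) ^ k₁)⁻¹ * ∏ l, ((1 + a * ‖x l‖) ^ 6)⁻¹) := by gcongr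
    _ = _ := by ring

/-- **(b) The seam bound** (second conjunct of `stub_ptuAnalysis`), with `c = 64 K₀`, `K₀ = 81 ∑ₘ (m+1)⁻²`. [folklore] -/
theorem ptuAnalysis_seam : ∃ c : ℝ, 0 < c ∧ ∀ (N p : ℕ) (a : ℝ) (L : ℕ) (F : 𝓢((Fin p → EuclideanSpace ℝ (Fin 4)), ℂ)),
    0 < a → a ≤ 1 → a⁻¹ ≤ (a * L) ^ N →
    ∑ x ∈ (Finset.univ : Finset (Fin p → ↥(box 4 L))).filter
        (fun x => ∃ (i : Fin p) (μ : Fin 4), (L : ℝ) < 8 * |(((x i : Site 4) μ : ℤ) : ℝ)|),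
      ‖F (fun i => a • siteToE (↑(x i) : Site 4))‖ ≤
      (c * 2 ^ (16 * N)) ^ (p + 1) * schwartzNorm (p * (4 * N + 6)) F := by
  set K₀ : ℝ := 81 * ∑' m : ℕ, (((m : ℝ) + 1) ^ 2)⁻¹ with hK₀
  have hK₀1 : 1 ≤ K₀ := by
    have h1 : ((((0 : ℕ) : ℝ) + 1) ^ 2)⁻¹ ≤ ∑' m : ℕ, (((m : ℝ) + 1) ^ 2)⁻¹ :=
      summable_inv_succ_sq.le_tsum 0 (fun m _ => by positivity)
    norm_num at h1
    linarith
  have hK₀0 : 0 < K₀ := by linarith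
  refine ⟨64 * K₀, by positivity, ?_⟩
  intro N p a L F ha ha1 haL
  set s := (Finset.univ : Finset (Fin p → ↥(box 4 L))).filter
    (fun x => ∃ (i : Fin p) (μ : Fin 4), (L : ℝ) < 8 * |(((x i : Site 4) μ : ℤ) : ℝ)|) with hs
  have hidx : p * (4 * N + 6) = 4 * p * N + 6 * p := by ring
  rw [hidx]
  set S := schwartzNorm (4 * p * N + 6 * p) F with hS
  have hS0 : 0 ≤ S := schwartzNorm_nonneg _ F
  set t : ℝ := a * L with ht
  have ht0 : 0 ≤ t := by positivity
  -- pointwise: the seam configurations are far from the origin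
  have hpt : ∀ x ∈ s, ‖F (fun i => a • siteToE (↑(x i) : Site 4))‖ ≤
      2 ^ (4 * p * N + 6 * p) * S * ((1 + t / 8) ^ (4 * p * N))⁻¹ *
        ∏ l, ((1 + a * ‖(x l : Site 4)‖) ^ 6)⁻¹ := by
    intro x hx
    obtain ⟨i, μ, hiμ⟩ := (Finset.mem_filter.1 hx).2
    have hRle : t / 8 ≤ ‖(fun l => a • siteToE (x l : Site 4) : Fin p → EuclideanSpace ℝ (Fin 4))‖ := by
      have h1 : |(((x i : Site 4) μ : ℤ) : ℝ)| ≤ ‖siteToE (x i : Site 4)‖ := abs_coord_le_norm_siteToE _ μ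
      have h2 : ‖a • siteToE (x i : Site 4)‖ ≤
          ‖(fun l => a • siteToE (x l : Site 4) : Fin p → EuclideanSpace ℝ (Fin 4))‖ :=
        norm_le_pi_norm (fun l => a • siteToE (x l : Site 4) : Fin p → EuclideanSpace ℝ (Fin 4)) i
      rw [norm_smul, Real.norm_of_nonneg ha.le] at h2
      have h3 : a * (L : ℝ) ≤ a * (8 * |(((x i : Site 4) μ : ℤ) : ℝ)|) := mul_le_mul_of_nonneg_left hiμ.le ha.le
      have h4 : a * |(((x i : Site 4) μ : ℤ) : ℝ)| ≤ a * ‖siteToE (x i : Site 4)‖ := mul_le_mul_of_nonneg_left h1 ha.le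
      rw [ht]
      linarith
    exact ptuAnalysis_seam_norm_apply_le F ha.le (4 * p * N) (by positivity) (fun l => (x l : Site 4)) hRle
  -- the weights summed over distinct configurations
  have hinj : Set.InjOn (fun (c : Fin p → ↥(box 4 L)) (l : Fin p) => (c l : Site 4)) s :=
    fun c _ c' _ h => funext fun l => Subtype.ext (congrFun h l)
  have hsumw : ∑ c ∈ s, ∏ l, ((1 + a * ‖(c l : Site 4)‖) ^ 6)⁻¹ ≤ (a ^ 4)⁻¹ ^ p * K₀ ^ p :=
    nearDiag_sum_weights_le ha ha1 s (fun (c : Fin p → ↥(box 4 L)) l => (c l : Site 4)) hinj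
  -- numerics: `a^{-4p} ≤ t^{4pN}` and `t^{4pN} (1 + t/8)^{-4pN} ≤ 8^{4pN}`
  have ha4 : (a ^ 4)⁻¹ ^ p ≤ t ^ (4 * p * N) := by
    calc (a ^ 4)⁻¹ ^ p = a⁻¹ ^ (4 * p) := by rw [← inv_pow, ← pow_mul]
      _ ≤ (t ^ N) ^ (4 * p) := pow_le_pow_left₀ (inv_nonneg.2 ha.le) haL _
      _ = t ^ (4 * p * N) := by rw [← pow_mul]; ring
  have h8 : t ^ (4 * p * N) * ((1 + t / 8) ^ (4 * p * N))⁻¹ ≤ 8 ^ (4 * p * N) := by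
    rw [← div_eq_mul_inv, div_le_iff₀ (by positivity), ← mul_pow]
    exact pow_le_pow_left₀ ht0 (by linarith) _
  have hnum : 2 ^ (4 * p * N + 6 * p) * ((1 + t / 8) ^ (4 * p * N))⁻¹ * ((a ^ 4)⁻¹ ^ p * K₀ ^ p) ≤
      (64 * K₀ * 2 ^ (16 * N)) ^ p := by
    calc 2 ^ (4 * p * N + 6 * p) * ((1 + t / 8) ^ (4 * p * N))⁻¹ * ((a ^ 4)⁻¹ ^ p * K₀ ^ p)
        ≤ 2 ^ (4 * p * N + 6 * p) * ((1 + t / 8) ^ (4 * p * N))⁻¹ * (t ^ (4 * p * N) * K₀ ^ p) := by gcongr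
      _ = 2 ^ (4 * p * N + 6 * p) * (t ^ (4 * p * N) * ((1 + t / 8) ^ (4 * p * N))⁻¹) * K₀ ^ p := by ring
      _ ≤ 2 ^ (4 * p * N + 6 * p) * 8 ^ (4 * p * N) * K₀ ^ p := by gcongr
      _ = (64 * K₀ * 2 ^ (16 * N)) ^ p := by
          have eL : (2 : ℝ) ^ (4 * p * N + 6 * p) * 8 ^ (4 * p * N) * K₀ ^ p = 2 ^ (16 * p * N + 6 * p) * K₀ ^ p := by
            rw [show (8 : ℝ) = 2 ^ 3 by norm_num, ← pow_mul, ← pow_add,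
              show 4 * p * N + 6 * p + 3 * (4 * p * N) = 16 * p * N + 6 * p by ring]
          have eR : ((64 : ℝ) * K₀ * 2 ^ (16 * N)) ^ p = 2 ^ (16 * p * N + 6 * p) * K₀ ^ p := by
            rw [mul_pow, mul_pow, show (64 : ℝ) = 2 ^ 6 by norm_num, ← pow_mul, ← pow_mul, mul_right_comm, ← pow_add,
              show 6 * p + 16 * N * p = 16 * p * N + 6 * p by ring]
          exact eL.trans eR.symm
  have hc1 : 1 ≤ 64 * K₀ * 2 ^ (16 * N) := by
    have h2 : (1 : ℝ) ≤ 2 ^ (16 * N) := one_le_pow₀ (by norm_num)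
    nlinarith
  calc ∑ x ∈ s, ‖F (fun i => a • siteToE (↑(x i) : Site 4))‖
      ≤ ∑ x ∈ s, 2 ^ (4 * p * N + 6 * p) * S * ((1 + t / 8) ^ (4 * p * N))⁻¹ *
          ∏ l, ((1 + a * ‖(x l : Site 4)‖) ^ 6)⁻¹ := Finset.sum_le_sum hpt
    _ = 2 ^ (4 * p * N + 6 * p) * S * ((1 + t / 8) ^ (4 * p * N))⁻¹ *
          ∑ x ∈ s, ∏ l, ((1 + a * ‖(x l : Site 4)‖) ^ 6)⁻¹ := by rw [Finset.mul_sum]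
    _ ≤ 2 ^ (4 * p * N + 6 * p) * S * ((1 + t / 8) ^ (4 * p * N))⁻¹ * ((a ^ 4)⁻¹ ^ p * K₀ ^ p) :=
        mul_le_mul_of_nonneg_left hsumw (by positivity)
    _ = 2 ^ (4 * p * N + 6 * p) * ((1 + t / 8) ^ (4 * p * N))⁻¹ * ((a ^ 4)⁻¹ ^ p * K₀ ^ p) * S := by ring
    _ ≤ (64 * K₀ * 2 ^ (16 * N)) ^ p * S := mul_le_mul_of_nonneg_right hnum hS0
    _ ≤ (64 * K₀ * 2 ^ (16 * N)) ^ (p + 1) * S := by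
        refine mul_le_mul_of_nonneg_right ?_ hS0
        rw [pow_succ]
        exact le_mul_of_one_le_right (by positivity) hc1

/-! ## §3 The registered stub -/

/-- **Piece 3 — the analytic kit**: (a) the ABSTRACT flat/decay bound for an off-diagonal `F` times a smooth compactly
supported weight `w` with geometric derivative bounds, supported where some pair is `δ`-close and `‖y‖ ≥ d`
(Leibniz `norm_iteratedFDeriv_mul_le`; flatness of DERIVATIVES of `F` at the coincident point by the tree's
`OSLegsFromFemtoAndGap.norm_iteratedFDeriv_le_of_vanish` with the max-coordinate segment trick of
`offDiagonal_pow_mul_norm_le`; `(1+‖y‖)^K ≥ (1+d)^K`; `schwartzNorm` as a finite sup of seminorms,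
`Seminorm.finset_sup_apply_le`; `smulLeftCLM_apply_apply` with temperate growth from compact support); (b) the SEAM bound
(`SchwartzMap.one_add_le_sup_seminorm_apply`, `inv_one_add_norm_pow_le_prod`, `sum_prod_decay_le`, `a⁻⁴ᵖ ≤ (aL)^{4pN}`,
`(1 + aL/8)^{-4pN} (aL)^{4pN} ≤ 8^{4pN}`). [folklore] -/
theorem stub_ptuAnalysis :
    (∀ (p n M K : ℕ) (F : 𝓢((Fin p → EuclideanSpace ℝ (Fin 4)), ℂ)), IsOffDiagonal F →
        ∀ (w : (Fin p → EuclideanSpace ℝ (Fin 4)) → ℝ) (A D δ d : ℝ), ContDiff ℝ ∞ w → HasCompactSupport w →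
          0 ≤ A → 0 ≤ D → 0 ≤ δ → 0 ≤ d →
          (∀ i ≤ n, ∀ y : (Fin p → EuclideanSpace ℝ (Fin 4)), ‖iteratedFDeriv ℝ i w y‖ ≤ A * D ^ i) →
          (∀ y ∈ tsupport w, ∃ i j : Fin p, i ≠ j ∧ ‖y i - y j‖ ≤ δ) →
          (∀ y ∈ tsupport w, d ≤ ‖y‖) →
          schwartzNorm n (SchwartzMap.smulLeftCLM ℂ (fun y : (Fin p → EuclideanSpace ℝ (Fin 4)) => ((w y : ℝ) : ℂ)) F) ≤
            A * (2 * max 1 D) ^ n * 2 ^ (K + 1) * δ ^ M * ((1 + d) ^ K)⁻¹ * schwartzNorm (n + M + K) F) ∧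
      (∃ c : ℝ, 0 < c ∧ ∀ (N p : ℕ) (a : ℝ) (L : ℕ) (F : 𝓢((Fin p → EuclideanSpace ℝ (Fin 4)), ℂ)),
        0 < a → a ≤ 1 → a⁻¹ ≤ (a * L) ^ N →
        ∑ x ∈ (Finset.univ : Finset (Fin p → ↥(box 4 L))).filter
            (fun x => ∃ (i : Fin p) (μ : Fin 4), (L : ℝ) < 8 * |(((x i : Site 4) μ : ℤ) : ℝ)|),
          ‖F (fun i => a • siteToE (↑(x i) : Site 4))‖ ≤
          (c * 2 ^ (16 * N)) ^ (p + 1) * schwartzNorm (p * (4 * N + 6)) F) :=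
  ⟨ptuAnalysis_flat, ptuAnalysis_seam⟩

end Summit.QuantumFields.YangMills.Theorems.ContinuumLegGivenGap

end
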